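import Mathlib
import Summits.ValiantsHypothesis.ValiantsHypothesis.Theorems.DivisionGapPerMultiplesHardStubSpreadRigidity

/-!
# `DivisionGap.PerMultiplesHard` (stmt-ValiantsHypothesis-5068), line `uncharged-face-walk`:
type rigidity of spread probes for an ARBITRARY fixed row shift (stub `stub_spreadRigidityGen`)

The registered stub `stub_spreadRigidityGen`: for every permutation `ζ` of `Fin n` (the row shift),
all `S, T ⊆ Fin n` with `#S = k` in the window `n < 5k ≤ 2n`, the permutations `π` compatible with
`(S, T)` — every `i ∈ S` has `π⁻¹ i ∈ T ∨ π⁻¹ (ζ i) ∈ T`, and every `j ∈ T` has `π j ∈ S ∨ π j ∈ ζ(S)` —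
number at most `(4/5)^{⌊n/10⌋} · n!`, in `ℕ`: `# · 5^{⌊n/10⌋} ≤ 4^{⌊n/10⌋} · n!`.  This is exactly the
general-shift lemma `SpreadRigidity.spreadRigidity_gen` landed with the rotation case (p103668); this file
only gives it the registered name and signature, which the skeleton's spread engine `spreadPatterns`
consumes for every `ζ` (a cofactor may hide its two-cells-per-row monomials along any fixed shift). [folklore]
-/

set_option linter.dupNamespace false

namespace Summit.ValiantsHypothesis.ValiantsHypothesis.Theorems.DivisionGap.PerMultiplesHard.SpreadRigidityGen

open scoped NNReal BigOperators

/-- **Type rigidity of spread probes, general shift** (registered stub `stub_spreadRigidityGen`): for every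
`ζ : Equiv.Perm (Fin n)` and `S, T ⊆ Fin n` with `#S = k`, `n < 5k ≤ 2n`, the number of permutations `π` with
(a) `∀ i ∈ S, π⁻¹ i ∈ T ∨ π⁻¹ (ζ i) ∈ T` and (b) `∀ j ∈ T, π j ∈ S ∨ ∃ i ∈ S, ζ i = π j`, times `5^{⌊n/10⌋}`, is
at most `4^{⌊n/10⌋} · n!`.  One line from `SpreadRigidity.spreadRigidity_gen`. [folklore] -/
theorem stub_spreadRigidityGen :
    ∀ (n k : ℕ) (ζ : Equiv.Perm (Fin n)) (S T : Finset (Fin n)), S.card = k → n < 5 * k → 5 * k ≤ 2 * n →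
      ((Finset.univ : Finset (Equiv.Perm (Fin n))).filter fun π =>
          (∀ i ∈ S, π.symm i ∈ T ∨ π.symm (ζ i) ∈ T) ∧
          (∀ j ∈ T, π j ∈ S ∨ ∃ i ∈ S, ζ i = π j)).card * 5 ^ (n / 10) ≤
        4 ^ (n / 10) * n.factorial :=
  fun n k ζ S T hS hlo hhi => SpreadRigidity.spreadRigidity_gen n k ζ S T hS hlo hhi

end Summit.ValiantsHypothesis.ValiantsHypothesis.Theorems.DivisionGap.PerMultiplesHard.SpreadRigidityGen
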